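import Summits.HodgeConjecture.HodgeConjecture.Theses.HeckePrymWeil
import Summits.HodgeConjecture.HodgeConjecture.Theorems.WeilTenfoldsSqrtMinus11.Negative.EigenvalueSeparation
import Literature.AlgebraicGeometry.Motives.AbelianVarietyProduct
import Literature.AlgebraicGeometry.Motives.AbelianVarietyProductDimProofs
import Literature.AlgebraicGeometry.Motives.HyperbolicWeilType
import Literature.AlgebraicGeometry.Motives.WeilDiscriminantRealization
import Literature.AlgebraicGeometry.HodgeTheory.WeilClassesFourfoldsProofs
import Literature.AlgebraicGeometry.HodgeTheory.SemiregularVariationalHodge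
import Literature.AlgebraicGeometry.HodgeTheory.KaehlerClass
import HarnessLib.Audit

/-!
# Line `generic-ppav-secant-descent` — skeleton for crux `HeckePrymWeil.WeilTenfoldsSqrtMinus11`
(item stmt-HodgeConjecture-1262, route route-HodgeConjecture-HeckePrymWeil; crux-plan, planner
`planner-cruxplan-stmt-HodgeConjecture-1262-generic-ppav-secant--0`, 2026-08-16)

Crux (FIXED, the route's typing): on every complex abelian TENFOLD `A` with `φ ≫ φ = -11` every
rational `(5,5)`-class in the Weil span `Eig((𝟙+φ)^*, (1+i√11)¹⁰) ⊔ Eig((𝟙+φ)^*, (1-i√11)¹⁰) ⊆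
H¹⁰(A(ℂ); ℂ)` is algebraic — every discriminant class `det H ∈ ℚ^×/Nm(K^×)`, `K = ℚ(√-11)`; open in
every component (nothing is decided for any `K` in dimension `≥ 8`).

Idea (crux idea card `Cruxes/WeilTenfoldsSqrtMinus11/Ideas/generic-ppav-secant-descent.md`, triage
`TRIAGE-r1-{1,2,3}.md`: pass ×3). Crux ⟸ T₊ ∧ D:
* T₊ = Hodge–Weil classes are algebraic on the `ℚ(√-11)`-Weil TWELVEFOLDS of discriminant class
  `+1 = (-11)⁶` — the HYPERBOLIC class, the one containing the 21-dimensional family of SECANT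
  ANCHORS `X × X̂` (`X` any abelian sixfold, Markman arXiv:2502.03415 Prop. 1.2.1, Lemma 3.1.3),
  reached by Markman's K-secant engine run with a NEW component supply: a simple rank-2
  `P`-secant object `F`, `ch F = ch 𝓘_Z(Θ) + ch 𝒪(Θ) = 2α + 2β` (`α + √-11 β = e^{√-11 Θ}`), whose
  support `Z = 12·(Θ∩Θ') + 4·Θ³ + 57·Θ⁴ + 36·Θ⁵ + 462 pts` is a union of generic translates of THETA
  COMPLETE INTERSECTIONS — subvarieties that exist and deform on EVERY ppav, so that the Matsusaka–Ran
  obstruction of Jacobian supports (Markman Ex. 8.2.3 / Q. 8.2.4, triage barrier note B11) is absent;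
  the bookkeeping is integral exactly for `n ≤ 6` and, among `d ≤ 44`, at `n = 5, 6` only for `d = 11`
  (card; re-run to the digit by all three triagers, kit j010200/j010218); `12 = d + 1` theta-CI
  fourfolds carry Markman's `ℤ/12` Ext²-cutting symmetry (TRIAGE-r1-3 sharpening).
* D = ONE-CLASS DESCENT: for a tenfold `(A, φ)` of class `δ` the CM Weil surface `B = E × E`,
  `E = ℂ/ℤ[(1+√-11)/2]` (`h(-11) = 1`), `φ_B = (ι, -ι)`, with FREE polarisation weights `(m₁, m₂)`
  has `det H_B ≡ -m₁m₂`, so `A × B` is a twelvefold of class `δ·(-m₁m₂)·… ≡ +1` for the right weights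
  (`ℚ^×/Nm K^×` is 2-torsion, `det H` multiplicative); Schoen's `pr_{A*}(z·(A × D))` with a NON-product
  test class (`b± ⌣ η ≠ 0`) and the `2×2` inversion `λ ≠ λ̄` (landed `weil_plus_pow_ne_minus_pow`)
  return the Weil classes of `A`. ONE twelvefold class serves EVERY tenfold class — this line never
  asks for non-hyperbolic twelvefolds (≠ item 1263 `WeilDescending` at `m = 6`).

The six registered stubs (signatures over existing Literature / Mathlib declarations only; no local
definitions; the Weil span always in the ROUTE's single-operator typing):

T₊ side (the card's content; engine-faithful):
* `stub_secantSpread` — **γ, THE BET (hardest)**: THERE IS a split (off-diagonal: `e₀` idempotent,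
  `e₀ψ₀e₀ = 0 = (1-e₀)ψ₀(1-e₀)`, i.e. `A₀ ≃ B × C` — the secant anchors `X × X̂`), hyperbolic,
  `K`-compatibly POLARISED (`h₀` Kähler, `ψ₀^*h₀ = 11h₀`) `ℚ(√-11)`-anchor twelvefold THROUGH WHICH the
  variational Hodge conjecture holds for the rational `(6,6)` Weil classes, on the tree's real family
  carriers (`Motives.IsSmoothProjectiveFamily`, `FiberClass`, `locusOfHodgeClasses`, as in the
  renderings of Buchweitz–Flenner Thm 5.1 / Perry 2026 Thm 1.1 (2) in
  `HodgeTheory/SemiregularVariationalHodge`): along every smooth projective family of twelvefolds over a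
  smooth integral quasi-projective base with a fibre identified with `A₀`, every flat family `w` of
  rational `(6,6)` classes with `w(s₀)` in the Weil plane of `(A₀, ψ₀)`, the compatible polarisation
  staying Hodge, is ALGEBRAIC ON EVERY FIBRE. This is exactly what a semiregular (twisted) secant
  object `E₀` on ONE anchor with `κ(E₀) ∈ ℚ[h₀] ⊕ W`, `W`-part `≠ 0`, delivers through Perry/BF–Pridham
  (Markman §1.5, proved for abelian varieties) — and nothing more. Size XL / OPEN.
* `stub_moduliReach` — γ ⟹ T₊ (Weil classes on ALL hyperbolic `K`-compatibly polarised twelvefolds,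
  typed with the tree's real-carrier predicates `Motives.IsHyperbolicWeilType X ψ 6 h` and
  `IsKaehlerClass`, TRIAGE-r1-2 sharpening "lever-faithful T₊"): PEL Shimura family with neat level
  through THE anchor (smooth, quasi-projective, connected), Landherr (all hyperbolic rank-12
  `K`-Hermitian spaces are isometric ⟹ every hyperbolic `(X, ψ, h)` is `K`-isogenous to a fibre), the
  Weil plane as a rank-2 flat sub-system of type `(6,6)` everywhere, and the tree's PROVED isogeny
  descent `mem_algebraicClasses_of_isogeny_of_mem_weilClassesOf`. Size L–XL (true classically).
D side (shared machinery with line `hyperbolic-eightfold-descent` of the sibling crux 1260, one rung up):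
* `stub_aimingArithmetic` — the free-weights lever at `d = 11` (Landherr from Meyer, provable now, M).
* `stub_hyperbolicPartner` — the CM Weil surface `E_{√-11} × E_{√-11}` with a DESCENT PAIR and a
  hyperbolic compatible divisor class on `A × B` (classically one page; Lean XL).
* `stub_hodgeTypeExterior` — Künneth for Hodge types on `A × B` (VERBATIM the sibling line's stub:
  one proof closes both; L).
* `stub_descent` — Schoen's descent `12 → 10` for ONE partner surface (L).

`WeilTenfoldsSqrtMinus11_of` takes the six statements as hypotheses (keyed BY NAME as
`Registered.stub_…`, `rfl`-aliases of the stubs' literal types; a closed sorry-free theorem) and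
concludes the crux BY NAME; `WeilTenfoldsSqrtMinus11_of_stubs` feeds it the stubs. Glue proved inside `_of`: the case `c = 0`; `(A × B).dim = 12` (`dim_prod`);
`(φ × φ_B)² = -11` (`prodLift_comp_self_eq_neg_nsmul`, `ℕ`- vs `ℤ`-scalar `11`).

Disproof used (`Cruxes/WeilTenfoldsSqrtMinus11/Disproof.lean`, cdisprove cycle 1, + LANDED
`Theorems/WeilTenfoldsSqrtMinus11/Negative/EigenvalueSeparation.lean`, p73707 — imported here):
(F1) `not_hodgeConjecture_of_not`: every stub below is a consequence of HC (S1, S2, S6) or a theorem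
(S3–S5) — none is refutable short of ¬HC; §B `WithoutHodgeType` FALSE (`E¹⁰`): `hhodge` is KEPT and
USED — S4 needs the `(5,5)` witness, S5/S6 turn `(5,5) ⊠ (1,1)` into `(6,6)`, S1/S2 carry `(6,6)`
in `locusOfHodgeClasses` / `IsOfHodgeType`; `WithoutRat ≡ crux`: rationality is used by the projector
step of S6 and the flat `ℚ`-sections of S1/S2; §C (landed): `weil_plus_pow_ne_minus_pow`,
`weil_mixed_ne_plus/minus` at `p = 11`, degree 12 are re-instantiated below (`weil12_*`, sorry-free) —
they are the `λ ≠ λ̄` of the `2×2` inversion in S1/S2 and the separation of the product eigenvalues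
`λ₊¹⁰λ₋², λ₊²λ₋¹⁰` from `λ±¹²` in S6; SCOPE REMARK "every δ": honoured — D reaches every tenfold class
from the single twelvefold class `+1`. No landed Negative lemma refutes an instance of any stub
(the Negative file contains arithmetic and summit-hardness only). `ledger negatives`: 2 entries,
unrelated (Fermat multisets; a 22×22 matrix identity).
-/

noncomputable section

open CategoryTheory Complex
open Literature.AlgebraicGeometry Literature.AlgebraicGeometry.Motives
  Literature.AlgebraicGeometry.HodgeTheory Literature.AlgebraicTopology.SingularHomology
open Summit.HodgeConjecture.HodgeConjecture.Theorems.WeilTenfoldsSqrtMinus11.Negative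

namespace Summit.HodgeConjecture.HodgeConjecture.Cruxes.WeilTenfoldsSqrtMinus11.GenericPpavSecantDescent

/-! ### Arithmetic of the typing in degree 12 (sorry-free; instances of the LANDED Negative lemmas) -/

/-- `λ ≠ λ̄` one rung up: `(1 + i√11)¹² ≠ (1 - i√11)¹²` — the scalar behind the `2×2` inversion
"one algebraic class with both eigencomponents non-zero ⟹ the whole Weil plane" used in S1/S2/S6
(instance of the landed `weil_plus_pow_ne_minus_pow`, `p = 11 ≠ 3`). -/
theorem weil12_plus_ne_minus :
    (1 + I * (Real.sqrt (11 : ℝ) : ℂ)) ^ 12 ≠ (1 - I * (Real.sqrt (11 : ℝ) : ℂ)) ^ 12 := by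
  have h := weil_plus_pow_ne_minus_pow (p := 11) (by norm_num) (by norm_num) (m := 12) (by norm_num)
  exact_mod_cast h

/-- Separation of the PRODUCT eigenvalues from the pure ones (S6, projector step): on `A × B` the
four pieces of `pr_A^* c ⌣ pr_B^*(b₊ + b₋)` have `(𝟙+ψ)^*`-eigenvalues `λ₊¹², λ₋¹², λ₊¹⁰λ₋², λ₊²λ₋¹⁰`;
no mixed one is `λ₊¹²` (instance of the landed `weil_mixed_ne_plus`). -/
theorem weil12_mixed_ne_plus (a b : ℕ) (hab : a + b = 12) (hb : 1 ≤ b) :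
    (1 + I * (Real.sqrt (11 : ℝ) : ℂ)) ^ a * (1 - I * (Real.sqrt (11 : ℝ) : ℂ)) ^ b ≠
      (1 + I * (Real.sqrt (11 : ℝ) : ℂ)) ^ 12 := by
  have h := weil_mixed_ne_plus (p := 11) (by norm_num) (by norm_num) hab hb
  exact_mod_cast h

/-- … and no mixed one is `λ₋¹²` (instance of the landed `weil_mixed_ne_minus`). -/
theorem weil12_mixed_ne_minus (a b : ℕ) (hab : a + b = 12) (ha : 1 ≤ a) :
    (1 + I * (Real.sqrt (11 : ℝ) : ℂ)) ^ a * (1 - I * (Real.sqrt (11 : ℝ) : ℂ)) ^ b ≠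
      (1 - I * (Real.sqrt (11 : ℝ) : ℂ)) ^ 12 := by
  have h := weil_mixed_ne_minus (p := 11) (by norm_num) (by norm_num) hab ha
  exact_mod_cast h

/-! ### The six registered stubs -/

/-- **Stub 1 — γ: a SECANT ANCHOR THROUGH WHICH WEIL CLASSES SPREAD (variational Hodge for Weil
classes through one split hyperbolic `ℚ(√-11)`-anchor; THE BET; hardest; the secant engine's exact
deliverable).** There exist a complex abelian twelvefold `A₀`, an endomorphism `ψ₀` with
`ψ₀ ≫ ψ₀ = -11`, an idempotent `e₀` with `e₀ψ₀e₀ = 0`, `(𝟙-e₀)ψ₀(𝟙-e₀) = 0` (so `A₀ = B × C`,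
`ψ₀ = (0 β; γ 0)`, `βγ = γβ = -11`: a SPLIT = off-diagonal anchor; intended: Markman's secant anchor
`X × X̂`, `X` a principally polarised abelian SIXFOLD at which the theta-CI secant object below is
semiregular — an open dense condition on `X ∈ A₆`, Prop. 1.2.1), and a class `h₀ ∈ H²(A₀(ℂ); ℂ)` which
is rational, supported on a divisor, `ψ₀`-compatible (`ψ₀^* h₀ = 11 h₀`), with `Q_{h₀} = h₀¹¹ ⌣ · ⌣ ·`
non-degenerate on `H¹`, KÄHLER (the tree's real-carrier positivity predicate `IsKaehlerClass`: `h₀` is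
the class of a `K`-compatible POLARISATION) and of HYPERBOLIC Weil type (`det H = +1`; automatic for
`(X × X̂, ψ_sec, h_sec)`: `(-11)⁶ ≡ 1`, Lemma 3.1.3), SUCH THAT: for every smooth projective family
`π : 𝒳 → S` of relative dimension `12` over a smooth, integral, quasi-projective `ℂ`-scheme `S`, every
pair of FLAT families of classes `hh` (degree 2) and `w` (degree 12) (continuous sections of the
étalé spaces `FiberClass π k`) with values in the locus of Hodge classes (rational, of type `(1,1)`
resp. `(6,6)`) at EVERY point, and every point `s₀` whose fibre is identified (`ι₀`) with `A₀.X` so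
that `hh(s₀) = ι₀^* h₀` and `w(s₀) = ι₀^* c₀` with `c₀` in the Weil plane
`Eig((𝟙+ψ₀)^*, (1+i√11)¹²) ⊔ Eig((𝟙+ψ₀)^*, (1-i√11)¹²)` of `(A₀, ψ₀)` — the class `w(s)` is ALGEBRAIC
on the fibre `𝒳_s` for EVERY `s ∈ S(ℂ)`. (These are the tree's real family carriers
`Motives.IsSmoothProjectiveFamily`, `FiberClass`, `locusOfHodgeClasses`, exactly as in the renderings
of Buchweitz–Flenner Thm 5.1 / Perry 2026 Thm 1.1 (2) in `HodgeTheory/SemiregularVariationalHodge`.)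
Intended proof = the card's lever: on `X` a SIMPLE rank-2 `P`-secant object `F` (`ch F = 2α + 2β`,
`α + √-11 β = e^{√-11 Θ}`, theta-CI support `12·(Θ∩Θ') + 4·Θ³ + 57·Θ⁴ + 36·Θ⁵ + 462` points,
`ℤ/12`-invariant), Orlov/Fourier–Mukai transfer to a reflexive sheaf `E₀` on `X × X̂` with
`κ(E₀) ∈ ℚ[h₀] ⊕ W`, `W`-part `≠ 0` (Markman Cor. 1.3.2: `Spin(V)_P`-invariance, valid for every
`n`), SEMIREGULARITY of (an equivariant descent of) `E₀` — `rank ob_F = n(n-1) = 30` on `HT²(X)`, i.e.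
`ker ob_F = Ann(P)` (card; `= 6` at `n = 3` is Markman Prop. 8.3.9) — then Perry 2026 Thm 1.1 (2) /
Buchweitz–Flenner Thm 5.1 + Pridham for twisted sheaves on abelian varieties (Markman §1.5, proved for
abelian varieties): `κ(E₀)` remains algebraic wherever it remains Hodge; the hypotheses on `hh`, `w`
say exactly that (the other components of `κ` are powers of `h₀`; the Hodge locus of `(c₀, h₀)` at
`s₀` is the 36-dimensional Weil germ — first order: `ξ(V_σ^{1,0}) ⊆ V_σ^{0,1}` and conjugate — so by
CDK + irreducibility of `S` the whole family stays in the hyperbolic polarised Weil component, the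
`W`-part of `κ(E₀)` stays Hodge, and the second Weil generator is handled by the `K`-translates /
`2×2` inversion, `weil12_plus_ne_minus`). For the constant family this contains the anchor lemma "Weil
classes of `X × X̂` are algebraic" — free here (`κ` of a sheaf is algebraic; classically also
diagonal-`Sp(H¹X)`-invariance + FFT, Milne 1999). ∃-form on purpose: ONE anchor where the engine runs;
Stub 2 carries it to the whole hyperbolic class, so no claim is made at special split anchors.
Why it might fail: `rank ob_F > 30` (theta-CI supports obstructed along the `15` gerbe/Poisson
directions of `Ann(P)` — card falsifier (c); control computation (b) at `n = 3` first), or no SIMPLE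
rank-2 object with this `ch` (residual falsifier (a)).
[informal size XL; open — Markman Q. 8.2.4 two genera up, with theta-CI instead of Brill–Noether supports] -/
theorem stub_secantSpread :
    ∃ (A₀ : AbelianVariety ℂ) (ψ₀ e₀ : A₀ ⟶ A₀) (h₀ : complexBetti A₀.X 2),
      A₀.dim = 12 ∧ ψ₀ ≫ ψ₀ = -((11 : ℤ) • 𝟙 A₀) ∧
      e₀ ≫ e₀ = e₀ ∧ e₀ ≫ ψ₀ ≫ e₀ = 0 ∧ (𝟙 A₀ - e₀) ≫ ψ₀ ≫ (𝟙 A₀ - e₀) = 0 ∧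
      IsRationalClass h₀ ∧ h₀ ∈ algebraicClasses A₀.X 1 ∧
      complexBetti.map ψ₀.hom.hom.hom 2 h₀ = (11 : ℂ) • h₀ ∧
      (∀ x : complexBetti A₀.X 1,
        (∀ y : complexBetti A₀.X 1, polarizationPairingOne A₀.X h₀ 11 x y = 0) → x = 0) ∧
      IsKaehlerClass 12 A₀.X h₀ ∧ IsHyperbolicWeilType A₀ ψ₀ 6 h₀ ∧
      ∀ (𝒳 S : SchemeOver ℂ) (π : 𝒳 ⟶ S),
        IsSmoothProjectiveFamily π 12 → IsQuasiProjectiveOver S →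
        _root_.AlgebraicGeometry.IsIntegral S.left → _root_.AlgebraicGeometry.Smooth S.hom →
      ∀ (hh : ∀ s : ComplexPoints S, complexBetti (fiberOver π s) (2 * 1))
        (w : ∀ s : ComplexPoints S, complexBetti (fiberOver π s) (2 * 6)),
        Continuous (fun s => (⟨s, hh s⟩ : FiberClass π (2 * 1))) →
        Continuous (fun s => (⟨s, w s⟩ : FiberClass π (2 * 6))) →
        (∀ s, (⟨s, hh s⟩ : FiberClass π (2 * 1)) ∈ locusOfHodgeClasses π 12 1) →
        (∀ s, (⟨s, w s⟩ : FiberClass π (2 * 6)) ∈ locusOfHodgeClasses π 12 6) →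
      ∀ (s₀ : ComplexPoints S) (ι₀ : fiberOver π s₀ ≅ A₀.X) (c₀ : complexBetti A₀.X 12),
        c₀ ∈ Module.End.eigenspace (complexBetti.map (𝟙 A₀ + ψ₀).hom.hom.hom 12).hom
                ((1 + Complex.I * (Real.sqrt (11 : ℝ) : ℂ)) ^ 12) ⊔
              Module.End.eigenspace (complexBetti.map (𝟙 A₀ + ψ₀).hom.hom.hom 12).hom
                ((1 - Complex.I * (Real.sqrt (11 : ℝ) : ℂ)) ^ 12) →
        hh s₀ = complexBetti.map ι₀.hom (2 * 1) h₀ →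
        w s₀ = complexBetti.map ι₀.hom (2 * 6) c₀ →
      ∀ s : ComplexPoints S, w s ∈ algebraicClasses (fiberOver π s) 6 := by
  sorry

/-- **Stub 2 — moduli reach: γ ⟹ T₊ (Weil classes on HYPERBOLIC `ℚ(√-11)`-Weil twelvefolds).**
GIVEN Stub 1: for a complex abelian twelvefold `X` with `ψ ≫ ψ = -11` and a class `h ∈ H²(X(ℂ); ℂ)`
which is rational, supported on a divisor (`h ∈ N¹H²`), `ψ`-compatible (`ψ^* h = 11 h`), whose
polarisation pairing `Q_h = h¹¹ ⌣ (· ⌣ ·)` is non-degenerate on `H¹`, which is KÄHLER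
(`IsKaehlerClass 12 X.X h` — so `h` is a genuine `K`-compatible polarisation class and the typing has
no indefinite junk instances: TRIAGE-r1-2's "lever-faithful T₊"), and for which `(X, ψ, h)` is of
HYPERBOLIC Weil type (`Motives.IsHyperbolicWeilType X ψ 6 h`: a `ψ^*`-stable rational
`Q_h`-Lagrangian `12`-frame of `H¹`; van Geemen 5.2/5.4: Witt index `6`, `det H = (-1)⁶ = +1`, the
class of every secant anchor `X₆ × X̂₆`, `(-11)⁶ ≡ 1`), every rational `(6,6)`-class of the Weil span
`Eig((𝟙+ψ)^*, (1+i√11)¹²) ⊔ Eig((𝟙+ψ)^*, (1-i√11)¹²)` is algebraic. Proof (classical moduli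
theory): all hyperbolic `K`-Hermitian spaces of rank 12 are isometric up to a positive rational
scalar (Landherr; van Geemen 5.4 (5.4.1)), so `(H₁(X,ℚ), H_h)` is isometric to the Hermitian space of
THE anchor `(A₀, ψ₀, h₀)` provided by Stub 1 (hyperbolic, `h₀` a `K`-compatible polarisation
class); the PEL Shimura variety of `U(H₀)` (lattice `H₁(A₀, ℤ)`, polarisation `E_{h₀}`) with neat
level is a smooth quasi-projective connected (the domain of `U(6,6)` is connected) fine moduli scheme
`S` with universal family `π`; the isometry transports the complex structure of `X` to a point of the
domain, so `X` is `K`-ISOGENOUS (with `h ↦` a positive multiple of the fibre's polarisation) to a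
fibre `𝒳_t`; after a finite étale base change the rank-2 local system `⋀¹²_K R¹π_*ℚ ⊆ R¹²π_*ℚ` is
trivial, giving flat rational sections `w₁, w₂` spanning the Weil plane of every fibre, of type
`(6,6)` everywhere (Weil type is constant on `S`), and `c₁(relative polarisation)` gives `hh`; Stub 1
makes `w₁(t), w₂(t)` algebraic on `𝒳_t`, hence the whole Weil plane of `𝒳_t` (a `ℂ`-plane,
`dim = 2` via `H¹² = ⋀¹²H¹`), hence of `X` by the tree's PROVED isogeny descent
`HodgeTheory.mem_algebraicClasses_of_isogeny_of_mem_weilClassesOf` (van Geemen 3.6–3.7).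
Not a costume: it is the anchor-to-component bridge, with its own content (Shimura family, Landherr,
flat Weil sections as continuous sections of `FiberClass`, `dim(Eig₊ ⊔ Eig₋) = 2` via `H¹² = ⋀¹²H¹`,
isogeny); Stub 1 is strictly about families through its one anchor.
[informal size L–XL (no Shimura varieties of PEL type / Baily–Borel on real carriers yet); true] -/
theorem stub_moduliReach :
    (type_of% stub_secantSpread) →
    ∀ (X : AbelianVariety ℂ) (ψ : X ⟶ X), X.dim = 12 → ψ ≫ ψ = -((11 : ℤ) • 𝟙 X) →
    ∀ h : complexBetti X.X 2, IsRationalClass h → h ∈ algebraicClasses X.X 1 →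
      complexBetti.map ψ.hom.hom.hom 2 h = (11 : ℂ) • h →
      (∀ x : complexBetti X.X 1,
        (∀ y : complexBetti X.X 1, polarizationPairingOne X.X h 11 x y = 0) → x = 0) →
      IsKaehlerClass 12 X.X h → IsHyperbolicWeilType X ψ 6 h →
    ∀ c : complexBetti X.X 12, IsRationalClass c → IsOfHodgeType 12 X.X 12 6 6 c →
      c ∈ Module.End.eigenspace (complexBetti.map (𝟙 X + ψ).hom.hom.hom 12).hom
            ((1 + Complex.I * (Real.sqrt (11 : ℝ) : ℂ)) ^ 12) ⊔
          Module.End.eigenspace (complexBetti.map (𝟙 X + ψ).hom.hom.hom 12).hom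
            ((1 - Complex.I * (Real.sqrt (11 : ℝ) : ℂ)) ^ 12) →
      c ∈ algebraicClasses X.X 6 := by
  sorry

/-- **Stub 3 — the free-weights lever `δ·(-m₁m₂) ≡ +1`, as arithmetic of Hermitian forms over
`K = ℚ(√-11)` (Landherr for our purpose; provable now from Meyer's theorem, `meyer_holds`).** Let
`K ∋ α`, `α² = -11`, `K = ℚ + ℚ α`; `V` a `K`-space of dimension `2n`; `E` an alternating `ℚ`-bilinear
form on `V` of Weil type (`E(α x, α y) = 11 E(x, y)`) whose Hermitian form
`H(x, y) = E(x, α y) + α E(x, y)` (van Geemen 5.2 (2); `H(x, x) = E(x, α x) ∈ ℚ`) has SIGNATURE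
`(n, n)`: `V ⊇ P ⊕ N` with `H` positive definite on `P`, negative definite on `N`,
`dim_K P = dim_K N = n`. Then for all rationals `r₁, r₂` of the same sign there are positive integers
`m₁, m₂` such that the orthogonal sum of `E` and the binary Weil form `Im⟨m₁ r₁, -m₂ r₂⟩` on `K²`
(`diagWeilForm`, Gram matrix `diag(m₁ r₁, -m₂ r₂)`, signature `(1,1)`) is HYPERBOLIC: `V × K²`
contains a `K`-subspace of dimension `n + 1` on which the summed form vanishes identically
(`E|_L = 0 ⟺ H|_L = 0` on `K`-subspaces, `Motives.forall_weilHermitianForm_eq_zero_iff`).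
Proof sketch: `det H = (-1)ⁿ a`, `a > 0`; choose `m₁ = 1` and `m₂ = u v` where `a r₁ r₂ = u/v` in
lowest terms, so `a m₂ r₁ r₂ = u² ∈ (ℚ^×)² ⊆ Nm(K^×)` and the sum has signature `(n+1, n+1)` and
`det ≡ (-1)^{n+1}`; an indefinite Hermitian form of rank `≥ 3` over `K` is isotropic because its
trace form is an indefinite rational quadratic form of rank `≥ 6` (Meyer, Serre1973 IV §3.2 Cor. 2 =
`NumberTheory.QuadraticForms.meyer_holds`, PROVED), so by induction `H ⊕ ⟨r₁, -m₂ r₂⟩ ≅ Hypⁿ ⊕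
⟨x, -y⟩` with `xy ∈ Nm(K^×)`, and `⟨x, -y⟩` is then a hyperbolic plane (Deligne1982HodgeCycles
Cor. 4.2; van Geemen 5.4 (5.4.1)). Uniform in `d`: the sibling line's stub (crux 1260) is the `d = 7`
instance of the same lemma — prove once for all `d > 0` and specialise (`--supports`).
[informal size M] -/
theorem stub_aimingArithmetic :
    ∀ (K : Type) [Field K] [Algebra ℚ K] (α : K) (hα : α * α = algebraMap ℚ K (-11))
      (hK : ∀ k : K, ∃ a b : ℚ, k = algebraMap ℚ K a + algebraMap ℚ K b * α)
      (V : Type) [AddCommGroup V] [Module ℚ V] [Module K V] [IsScalarTower ℚ K V]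
      [Module.Finite K V] (n : ℕ), Module.finrank K V = 2 * n →
    ∀ (E : LinearMap.BilinForm ℚ V), (∀ x y : V, E x y = -E y x) →
      (∀ x y : V, E (α • x) (α • y) = 11 * E x y) →
      (∃ P N : Submodule K V, Module.finrank K P = n ∧ Module.finrank K N = n ∧ P ⊓ N = ⊥ ∧
        (∀ x ∈ P, x ≠ 0 → 0 < E x (α • x)) ∧ (∀ x ∈ N, x ≠ 0 → E x (α • x) < 0)) →
    ∀ r₁ r₂ : ℚ, 0 < r₁ * r₂ →
      ∃ m₁ m₂ : ℕ, 0 < m₁ ∧ 0 < m₂ ∧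
        ∃ L : Submodule K (V × (Fin 2 → K)), Module.finrank K L = n + 1 ∧
          ∀ x ∈ L, ∀ y ∈ L,
            bilinOrthSum E
              (diagWeilForm (d := 11) (by norm_num) hα hK (Pi.basisFun K (Fin 2))
                ![(m₁ : ℚ) * r₁, -((m₂ : ℚ) * r₂)]) x y = 0 := by
  sorry

/-- **Stub 4 — the hyperbolic partner (one-class aiming on the real carriers), GIVEN Stub 3.** For a
complex abelian tenfold `(A, φ)`, `φ ≫ φ = -11`, which is of Weil type — witnessed, as the crux
supplies it, by a NON-ZERO rational `(5,5)`-class in its Weil span — there exist a complex abelian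
SURFACE `B` with `φ_B ≫ φ_B = -11` carrying a DESCENT PAIR: eigenclasses
`b₊ ∈ Eig((𝟙+φ_B)^*, (1+i√11)²)`, `b₋ ∈ Eig((𝟙+φ_B)^*, (1-i√11)²)` in `H²(B(ℂ); ℂ)` with `b₊ + b₋`
rational of type `(1,1)`, and an algebraic class `η ∈ N¹H²(B(ℂ); ℂ)` with `b₊ ⌣ η ≠ 0`,
`b₋ ⌣ η ≠ 0` in `H⁴(B(ℂ); ℂ)` (a NON-product test class — the card's "`t` = diagonal, so that
`α = ∫_S b₊ ∪ t ≠ 0`"; Schoen 1998 §10), AND a class `h ∈ H²((A × B)(ℂ); ℂ)` — rational, supported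
on a divisor, compatible with `ψ = φ × φ_B` (`ψ^* h = 11 h`), with `Q_h` non-degenerate on `H¹`,
KÄHLER (an ample class: `IsKaehlerClass`, via `HodgeModel.exists_isKaehlerClassVia` / Fubini–Study
pull-back and `IsKaehlerClass.rat_smul_of_pos`) — for which `(A × B, ψ, h)` is of HYPERBOLIC Weil type
in half-dimension `6`. Intended witness (one
`B` serves every `A`; only the weights depend on `δ(A)`): `B = E × E`, `E = ℂ/ℤ[(1+√-11)/2]` (class
number one; `y² + y = x³ - x² - 7x + 10`, `j = -2¹⁵`), `φ_B = (ι, -ι)` with `ι = [√-11] ∈ End E`, so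
`B` is of Weil type `(1,1)` and its Weil plane consists of divisor classes; `h = pr_A^* h_A +
pr_B^*(m₁ pr₁^* h_E + m₂ pr₂^* h_E)` with `h_A` a `K`-compatible polarisation class of `A` (from any
polarisation `E₀` by `11 E₀ + φ^* E₀`; Disproof scope remark) and `(m₁, m₂)` from Stub 3 applied to
`(H₁(A, ℚ), E_A)` (Weil type `(5,5)` ⟹ signature `(5,5)`) with `r₁ = r₂ = r` (the twisted action
`(ι, -ι)` makes `H_B = ⟨m₁ r, -m₂ r⟩`), through the dictionary of `Motives/HyperbolicWeilType` (module
docstring (1)–(4): `H*(X) = ⋀*H¹`, `Q_h = c · E^* · vol`, `H|_W = 0 ⟺ E|_W = 0`,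
`H_{A×B} = H_A ⊕ t·H_B`, `t ∈ ℚ_{>0}`). The discriminant bookkeeping `det(A × B) = δ_A · (-m₁m₂ r²)
≡ +1` is the card's one-class descent (TRIAGE-r1-2/3 re-derived it).
[informal size: classically one page; Lean XL — CM curve with `ι` as an `AbelianVariety ℂ`
endomorphism, `H¹(E(ℂ))` eigen-bookkeeping, Künneth for `H¹` of a product, divisor classes on
carriers, a Hodge model of `B` for the `(1,1)` clause] -/
theorem stub_hyperbolicPartner :
    (type_of% stub_aimingArithmetic) →
    ∀ (A : AbelianVariety ℂ) (φ : A ⟶ A), A.dim = 10 → φ ≫ φ = -((11 : ℤ) • 𝟙 A) →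
    (∃ c : complexBetti A.X 10, c ≠ 0 ∧ IsRationalClass c ∧ IsOfHodgeType 10 A.X 10 5 5 c ∧
      c ∈ Module.End.eigenspace (complexBetti.map (𝟙 A + φ).hom.hom.hom 10).hom
            ((1 + Complex.I * (Real.sqrt (11 : ℝ) : ℂ)) ^ 10) ⊔
          Module.End.eigenspace (complexBetti.map (𝟙 A + φ).hom.hom.hom 10).hom
            ((1 - Complex.I * (Real.sqrt (11 : ℝ) : ℂ)) ^ 10)) →
    ∃ (B : AbelianVariety ℂ) (φB : B ⟶ B), B.dim = 2 ∧ φB ≫ φB = -((11 : ℤ) • 𝟙 B) ∧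
      (∃ bp bm η : complexBetti B.X 2,
        bp ∈ Module.End.eigenspace (complexBetti.map (𝟙 B + φB).hom.hom.hom 2).hom
              ((1 + Complex.I * (Real.sqrt (11 : ℝ) : ℂ)) ^ 2) ∧
        bm ∈ Module.End.eigenspace (complexBetti.map (𝟙 B + φB).hom.hom.hom 2).hom
              ((1 - Complex.I * (Real.sqrt (11 : ℝ) : ℂ)) ^ 2) ∧
        IsRationalClass (bp + bm) ∧ IsOfHodgeType 2 B.X 2 1 1 (bp + bm) ∧
        η ∈ algebraicClasses B.X 1 ∧
        cupProduct (show 2 + 2 = 4 from rfl) bp η ≠ 0 ∧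
        cupProduct (show 2 + 2 = 4 from rfl) bm η ≠ 0) ∧
      ∃ h : complexBetti (A.prod B).X 2,
        IsRationalClass h ∧ h ∈ algebraicClasses (A.prod B).X 1 ∧
        complexBetti.map (AbelianVariety.prodLift (AbelianVariety.fst A B ≫ φ)
            (AbelianVariety.snd A B ≫ φB)).hom.hom.hom 2 h = (11 : ℂ) • h ∧
        (∀ x : complexBetti (A.prod B).X 1,
          (∀ y : complexBetti (A.prod B).X 1,
            polarizationPairingOne (A.prod B).X h 11 x y = 0) → x = 0) ∧
        IsKaehlerClass 12 (A.prod B).X h ∧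
        IsHyperbolicWeilType (A.prod B) (AbelianVariety.prodLift (AbelianVariety.fst A B ≫ φ)
            (AbelianVariety.snd A B ≫ φB)) 6 h := by
  sorry

/-- **Stub 5 — Hodge types of exterior products (Künneth for Hodge models).** For complex abelian
varieties `A`, `B` of dimensions `a`, `b` and classes `c ∈ Hᵏ(A(ℂ); ℂ)` of type `(p, q)`,
`w ∈ Hˡ(B(ℂ); ℂ)` of type `(p', q')` (in the tree's sense `IsOfHodgeType`: for SOME Hodge model),
the exterior product `pr_A^* c ⌣ pr_B^* w ∈ H^{k+l}((A × B)(ℂ); ℂ)` is of type `(p + p', q + q')` for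
the dimension parameter `a + b` (Voisin I, §11.3.2 / Thm 11.38: the Künneth isomorphism is an
isomorphism of Hodge structures and `∪` is a morphism of Hodge structures). VERBATIM the statement of
`stub_hodgeTypeExterior` of the sibling line `Cruxes/WeilSixfoldsSqrtMinus7/Lines/hyperbolic-eightfold-descent.lean`
(one proof closes both); in the tree it reduces to `preservesHodgeType_of_nonempty_hodgeModel` +
`cupPreservesHodgeType_of_nonempty_hodgeModel` (`HodgeTypePullback`, `CupPreservesHodgeTypeOfDeRham`)
modulo the named fact `hodgePQ_independent_of_hodgeModel` and Hodge models of `A`, `B`, `A × B`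
(`AbelianVariety.isSmoothProjective_holds` + `HodgeModelExistence`). [informal size L] -/
theorem stub_hodgeTypeExterior :
    ∀ (A B : AbelianVariety ℂ) (a b : ℕ), A.dim = a → B.dim = b →
    ∀ (k l m : ℕ) (hklm : k + l = m) (p q p' q' : ℕ)
      (c : complexBetti A.X k) (w : complexBetti B.X l),
      IsOfHodgeType a A.X k p q c → IsOfHodgeType b B.X l p' q' w →
      IsOfHodgeType (a + b) (A.prod B).X m (p + p') (q + q')
        (cupProduct hklm (complexBetti.map (AbelianVariety.fst A B).hom.hom.hom k c)
          (complexBetti.map (AbelianVariety.snd A B).hom.hom.hom l w)) := by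
  sorry

/-- **Stub 6 — Schoen's descent `12 → 10` for ONE partner surface, GIVEN Stub 5.** Let `(A, φ)` be
a complex abelian tenfold and `(B, φ_B)` a complex abelian surface, `φ² = φ_B² = -11`, `B` carrying a
descent pair `(b₊, b₋, η)` as in Stub 4, and `ψ = φ × φ_B` on `A × B`. IF every rational
`(6,6)`-class in the Weil span `Eig((𝟙+ψ)^*, (1+i√11)¹²) ⊔ Eig((𝟙+ψ)^*, (1-i√11)¹²)` of `A × B` is
algebraic, THEN every rational `(5,5)`-class `c = c₊ + c₋` in the Weil span of `A` is algebraic.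
Proof (Schoen1998HodgeWeilAddendum §10; Markman2025SurveySecant §11.5 Step 2; the tree's PROVED
`4 ← 6` pattern `WeilClassesFourfoldsProofs.weilClassesOf_le_algebraicClasses_of_prod` /
`mem_algebraicClasses_of_gysin_fst_cupProduct`, one rung up and in single-operator typing):
`P = pr_A^* c ⌣ pr_B^*(b₊ + b₋)` is rational (`isRationalClass_cupProduct_map_fst_map_snd`) and
`(6,6)` (Stub 5); with `T = (𝟙 + ψ)^*` (`(𝟙+ψ) ≫ pr_A = pr_A ≫ (𝟙+φ)`) its four pieces have
eigenvalues `λ₊¹², λ₋¹², λ₊¹⁰λ₋², λ₊²λ₋¹⁰` (`λ± = 1 ± i√11`), pairwise distinct (`weil12_plus_ne_minus`,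
`weil12_mixed_ne_plus/minus` above — landed Negative lemmas), so `Q = q(T)P` and `TQ`
(`q(X) = (X - λ₊¹⁰λ₋²)(X - λ₊²λ₋¹⁰) ∈ ℤ[X]`) are rational `(6,6)` Weil classes of `A × B`
(`HodgeModel.pullback_map_mem_hodgePQ_of_endomorphism`), hence algebraic, hence so are
`P₊₊ = pr_A^* c₊ ⌣ pr_B^* b₊` and `P₋₋` (`mem_and_mem_of_smul_add_smul_mem`, `λ₊¹² ≠ λ₋¹²`);
`P±± ⌣ pr_B^* η ∈ N⁶H¹²` (cup with the flat pull-back of a divisor class after moving the divisor by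
a translation of `B`); and `pr_{A*}(P±± ⌣ pr_B^* η) = ε± · c±` with `ε± ≠ 0` because `b± ⌣ η ≠ 0`
spans `H⁴(B(ℂ); ℂ) ≅ ℂ` (real Gysin `complexGysin` + Poincaré duality, projection formula
`complexGysin_cup`, Gysin maps preserve `N^•`), so `c±`, hence `c`, are algebraic.
[informal size L] -/
theorem stub_descent :
    (type_of% stub_hodgeTypeExterior) →
    ∀ (A : AbelianVariety ℂ) (φ : A ⟶ A) (B : AbelianVariety ℂ) (φB : B ⟶ B),
      A.dim = 10 → B.dim = 2 → φ ≫ φ = -((11 : ℤ) • 𝟙 A) → φB ≫ φB = -((11 : ℤ) • 𝟙 B) →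
      (∃ bp bm η : complexBetti B.X 2,
        bp ∈ Module.End.eigenspace (complexBetti.map (𝟙 B + φB).hom.hom.hom 2).hom
              ((1 + Complex.I * (Real.sqrt (11 : ℝ) : ℂ)) ^ 2) ∧
        bm ∈ Module.End.eigenspace (complexBetti.map (𝟙 B + φB).hom.hom.hom 2).hom
              ((1 - Complex.I * (Real.sqrt (11 : ℝ) : ℂ)) ^ 2) ∧
        IsRationalClass (bp + bm) ∧ IsOfHodgeType 2 B.X 2 1 1 (bp + bm) ∧
        η ∈ algebraicClasses B.X 1 ∧
        cupProduct (show 2 + 2 = 4 from rfl) bp η ≠ 0 ∧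
        cupProduct (show 2 + 2 = 4 from rfl) bm η ≠ 0) →
      (∀ u : complexBetti (A.prod B).X 12, IsRationalClass u →
        IsOfHodgeType 12 (A.prod B).X 12 6 6 u →
        u ∈ Module.End.eigenspace (complexBetti.map (𝟙 (A.prod B) +
                AbelianVariety.prodLift (AbelianVariety.fst A B ≫ φ)
                  (AbelianVariety.snd A B ≫ φB)).hom.hom.hom 12).hom
              ((1 + Complex.I * (Real.sqrt (11 : ℝ) : ℂ)) ^ 12) ⊔
            Module.End.eigenspace (complexBetti.map (𝟙 (A.prod B) +
                AbelianVariety.prodLift (AbelianVariety.fst A B ≫ φ)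
                  (AbelianVariety.snd A B ≫ φB)).hom.hom.hom 12).hom
              ((1 - Complex.I * (Real.sqrt (11 : ℝ) : ℂ)) ^ 12) →
        u ∈ algebraicClasses (A.prod B).X 6) →
      ∀ c : complexBetti A.X 10, IsRationalClass c → IsOfHodgeType 10 A.X 10 5 5 c →
        c ∈ Module.End.eigenspace (complexBetti.map (𝟙 A + φ).hom.hom.hom 10).hom
              ((1 + Complex.I * (Real.sqrt (11 : ℝ) : ℂ)) ^ 10) ⊔
            Module.End.eigenspace (complexBetti.map (𝟙 A + φ).hom.hom.hom 10).hom
              ((1 - Complex.I * (Real.sqrt (11 : ℝ) : ℂ)) ^ 10) →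
        c ∈ algebraicClasses A.X 5 := by
  sorry

/-! ### Name-keyed aliases of the six statements (the hypotheses of the composition)

`Registered.stub_X` is the statement of `stub_X` (its literal type, via `type_of%`) under the registered
stub's short name, so that the native skeleton audit (`#h21_check_skeleton`: hypotheses admissible iff
registered obligations / declared stubs BY NAME) accepts
`WeilTenfoldsSqrtMinus11_of : Registered.stub_secantSpread → … → WeilTenfoldsSqrtMinus11` (device of
`Cruxes/FrequencyRigidity/Lines/kernel-fading-memory.lean` on the Navier–Stokes summit). Each alias is
`rfl`-equal to the stub's statement. -/
namespace Registered

/-- Alias of the statement of `stub_secantSpread`, keyed by the registered stub name. -/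
abbrev stub_secantSpread : Prop := type_of% _root_.Summit.HodgeConjecture.HodgeConjecture.Cruxes.WeilTenfoldsSqrtMinus11.GenericPpavSecantDescent.stub_secantSpread
/-- Alias of the statement of `stub_moduliReach`, keyed by the registered stub name. -/
abbrev stub_moduliReach : Prop := type_of% _root_.Summit.HodgeConjecture.HodgeConjecture.Cruxes.WeilTenfoldsSqrtMinus11.GenericPpavSecantDescent.stub_moduliReach
/-- Alias of the statement of `stub_aimingArithmetic`, keyed by the registered stub name. -/
abbrev stub_aimingArithmetic : Prop := type_of% _root_.Summit.HodgeConjecture.HodgeConjecture.Cruxes.WeilTenfoldsSqrtMinus11.GenericPpavSecantDescent.stub_aimingArithmetic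
/-- Alias of the statement of `stub_hyperbolicPartner`, keyed by the registered stub name. -/
abbrev stub_hyperbolicPartner : Prop := type_of% _root_.Summit.HodgeConjecture.HodgeConjecture.Cruxes.WeilTenfoldsSqrtMinus11.GenericPpavSecantDescent.stub_hyperbolicPartner
/-- Alias of the statement of `stub_hodgeTypeExterior`, keyed by the registered stub name. -/
abbrev stub_hodgeTypeExterior : Prop := type_of% _root_.Summit.HodgeConjecture.HodgeConjecture.Cruxes.WeilTenfoldsSqrtMinus11.GenericPpavSecantDescent.stub_hodgeTypeExterior
/-- Alias of the statement of `stub_descent`, keyed by the registered stub name. -/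
abbrev stub_descent : Prop := type_of% _root_.Summit.HodgeConjecture.HodgeConjecture.Cruxes.WeilTenfoldsSqrtMinus11.GenericPpavSecantDescent.stub_descent

end Registered

/-! ### The composition (concludes the crux BY NAME; sorry-free glue) -/

/-- **`WeilTenfoldsSqrtMinus11` from the six stubs.** Given a tenfold `(A, φ)` and a rational
`(5,5)` Weil class `c`: if `c = 0` it is algebraic; otherwise `c` witnesses Weil type, Stub 4 (fed
Stub 3) yields the partner surface `B`, its descent pair and a hyperbolic compatible divisor class
`h` on `A × B`; `A × B` has dimension `12` (`dim_prod`) and `(φ × φ_B)² = -11`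
(`prodLift_comp_self_eq_neg_nsmul`), so Stub 2 (fed Stub 1) makes the rational `(6,6)` Weil classes
of `(A × B, φ × φ_B)` algebraic, and Stub 6 (fed Stub 5) descends to `c`. -/
theorem WeilTenfoldsSqrtMinus11_of
    (h₁ : Registered.stub_secantSpread) (h₂ : Registered.stub_moduliReach)
    (h₃ : Registered.stub_aimingArithmetic) (h₄ : Registered.stub_hyperbolicPartner)
    (h₅ : Registered.stub_hodgeTypeExterior) (h₆ : Registered.stub_descent) :
    Summit.HodgeConjecture.HodgeConjecture.Theses.HeckePrymWeil.WeilTenfoldsSqrtMinus11 := by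
  intro A φ hA hφ c hrat hH hW
  by_cases hc : c = 0
  · rw [hc]
    exact Submodule.zero_mem _
  obtain ⟨B, φB, hB, hφB, hpair, h, hhr, hha, hhc, hhn, hhk, hhyp⟩ :=
    h₄ h₃ A φ hA hφ ⟨c, hc, hrat, hH, hW⟩
  have hdim : (A.prod B).dim = 12 := by rw [AbelianVariety.dim_prod, hA, hB]
  have hφ' : φ ≫ φ = -((11 : ℕ) • 𝟙 A) := by rw [hφ, ← natCast_zsmul]; rfl
  have hφB' : φB ≫ φB = -((11 : ℕ) • 𝟙 B) := by rw [hφB, ← natCast_zsmul]; rfl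
  have hsq : AbelianVariety.prodLift (AbelianVariety.fst A B ≫ φ) (AbelianVariety.snd A B ≫ φB) ≫
      AbelianVariety.prodLift (AbelianVariety.fst A B ≫ φ) (AbelianVariety.snd A B ≫ φB) =
        -((11 : ℤ) • 𝟙 (A.prod B)) := by
    rw [prodLift_comp_self_eq_neg_nsmul hφ' hφB', ← natCast_zsmul]; rfl
  exact h₆ h₅ A φ B φB hA hB hφ hφB hpair
    (h₂ h₁ (A.prod B) _ hdim hsq h hhr hha hhc hhn hhk hhyp) c hrat hH hW

/-- The crux from the stubs as they stand (depends on their `sorry`s; shows the composition closes). -/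
theorem WeilTenfoldsSqrtMinus11_of_stubs :
    Summit.HodgeConjecture.HodgeConjecture.Theses.HeckePrymWeil.WeilTenfoldsSqrtMinus11 :=
  WeilTenfoldsSqrtMinus11_of stub_secantSpread stub_moduliReach stub_aimingArithmetic
    stub_hyperbolicPartner stub_hodgeTypeExterior stub_descent

end Summit.HodgeConjecture.HodgeConjecture.Cruxes.WeilTenfoldsSqrtMinus11.GenericPpavSecantDescent
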